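import Summits.BirchSwinnertonDyer.BirchSwinnertonDyer.Theorems.ThetaPartnerAtTwoMazurTateCongruenceAtTwoTopOfManinConstant
import Summits.BirchSwinnertonDyer.BirchSwinnertonDyer.Theorems.ResidualThetaTransportAtTwoThetaLayerLambdaCongruenceAtTwoOfSdBz
import Mathlib.FieldTheory.IsAlgClosed.AlgebraicClosure
import HarnessLib

/-!
# Crux Kan⁺ `ThetaLayerLambdaCongruenceAtTwo` (stmt-BirchSwinnertonDyer-20688), line `birth`: THE COSOCLE ROAD —
# Kan⁺ from mod-`2` multiplicity one in QUOTIENT form ALONE (Hecke self-duality of `J₀(L)[2]` not used)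
# (width seat bsd-wall-rtt-p3-w3 g10; `--supports stmt-BirchSwinnertonDyer-20688`; THEOREMS ONLY — no `def`, no `sorry`; BSD is not proved)

STATE OF RECORD. Kan⁺ ⟸ PUB² {SD, Bz} (`thetaLayerLambdaCongruenceAtTwo_of_sdBz`, w3 g9 p644762): the index statement (K2)
`kTwo_of_dvd_noMC` obtains B4 = «`|Λ/𝔪₀Λ| ≤ 4`» (`Λ = periodHomology L = H₁(X₀(L); ℤ)`, `𝔪₀` the explicit mod-`2` eigen-ideal)
from multiplicity one in SUB form — `dim_{𝕋/𝔪₀} J₀(L)[𝔪₀] = 2` on the tree's Albanese torus `J0 L = S₂^∨/Λ`, the conclusion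
of `buzzard2000_multiplicityOne_gamma0` — CONVERTED by the Hecke-self-dual pairing on `J₀(L)[2]` (`heckeSelfDual_torsionBy_J0`).

THIS FILE threads the SAME chain from the QUOTIENT (cosocle) form `dim_{𝕋/𝔪₀} Λ/𝔪₀Λ = 2` directly, so that NO pairing / self-duality
enters anywhere:
* §1 `exists_fourCosets_periodHomology_of_cosocle` — B4 from `dim_{𝕋/𝔪} Λ/𝔪Λ = 2` and `|𝕋/𝔪| = 2` (pure counting);
* §2 `kTwo_of_dvd_of_mcCosocle` — (K2) at the crux's level from {MC} and the cosocle count at `𝔪₀` (= `kTwo_of_dvd_noMC` with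
  its two self-duality lines replaced by §1; statement otherwise verbatim, `hSD` and `hsub` replaced by `hcos`);
* §3 `of_buzzardHypotheses` — the Galois-side hypotheses of Buzzard's Prop. 2.4 AS TYPED (unramified with the Eichler–Shimura
  characteristic polynomials at `p ∤ 2L`, irreducible, non-scalar on the decomposition groups at `2`, over `k = 𝔽̄₂`) DISCHARGED at the
  mod-`2` eigen-ideal of a good-supersingular-at-`2` curve for an ARBITRARY conclusion `P` (= `finrank_torsionBySet_eq_two_of_buzzard`,
  tp2-p1-w4 g0, with the conclusion abstracted; proof copied) — so ANY fact of Buzzard's printed shape plugs in, whatever carrier its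
  conclusion is read on;
* §4 `cosocleAtEigenIdeal_of_cosocleFact` — the curve-level cosocle statement from a Buzzard-shaped fact whose conclusion is read on
  the PICARD side `J₀(N)[2] = H¹(X₀(N); ℤ/2) = Hom(Λ, ℤ/2)` (conclusion `dim_{𝕋/𝔪} Λ/𝔪Λ = 2`), spelled INLINE as a hypothesis
  (the named Literature fact is proposed separately; nothing here asserts it);
* §5 `plusLineCharTwo_of_mcCosocle`, `plusLineCharTwo_of_cosocle` — the plus line (C3k) with the conclusion of
  `plusLineCharTwo_of_sdBz` VERBATIM;
* §6 **`thetaLayerLambdaCongruenceAtTwo_of_cosocle_flatMuZeroAtTwo`**, **`thetaLayerLambdaCongruenceAtTwo_of_cosocle`** (FLAT from the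
  CLOSED node `CuspSpanEvenAtTwoOdd_proof`), **`thetaLayerLambdaCongruenceAtTwo_of_cosocleFact`** — Kan⁺ BY NAME from the curve-level
  cosocle statement, resp. from ONE Buzzard-shaped fact read on the Picard side.

WHY THE PICARD SIDE IS THE PRINTED SIDE (docstring of §4; the Literature proposal carries the full reading). Buzzard, MRL 7 (2000)
p. 100: «let `J(Γ)` denote its Jacobian. Let `T` be the Hecke algebra in `End(J(Γ))` generated (via Picard functoriality) by the
Hecke operators `T_n`». `J(Γ) = Pic⁰(X(Γ))`; by the exponential sequence `Pic⁰(X)(ℂ) = H¹(X, 𝒪)/H¹(X, ℤ)`, so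
`J(Γ)[2] = ½H¹(X, ℤ)/H¹(X, ℤ) = H¹(X; ℤ/2) = Hom(H₁(X; ℤ), ℤ/2)`, and Picard functoriality of a correspondence `C` acts on `H¹` by
`C^*`, the transpose of the covariant `C_*` on `H₁(X; ℤ) = Λ` — which is the tree's action `t • φ = φ ∘ T` (Darmon–Diamond–Taylor
§1.3 p. 32: the torus `V/Λ` carries the divisor PUSH-FORWARD action «`T_p((E, P)) = Σ (E/C, P mod C)`»). Hence Buzzard's
`J(Γ₀(N))[𝔪] = Hom(Λ/𝔪Λ, ℤ/2)` and «`T/𝔪`-dimension `2`» is `dim_{𝕋/𝔪} Λ/𝔪Λ = 2`. The tree's `buzzard2000_multiplicityOne_gamma0`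
reads `J[2]` instead as `½Λ/Λ ≅ Λ/2Λ` through Abel–Jacobi (DDT Thm. 1.15) and the `w_N`-twist; the two coordinates of `J[2]` differ
by Poincaré duality = the Weil pairing, i.e. by `heckeSelfDual_torsionBy_J0`.

HONEST FRAMING: every theorem is CONDITIONAL on its displayed hypotheses; nothing closes an item; BSD is not proved by any of this.

References: Buzzard, MRL 7 (2000) Prop. 2.4, Def. 2.1–2.2 [Buzzard2000LevelLoweringModTwo]; Darmon–Diamond–Taylor (1995) §1.3
(pp. 27–28, 32), §4.5 [DarmonDiamondTaylor1995]; Dokchitser–Dokchitser, Math. Z. 272 (2012) Theorem (1) [DokchitserDokchitserMathZ2012];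
BCDT, JAMS 14 (2001) p. 845 [BCDTJAMS2001]; Knapp (1993) Thm. 11.74 [Knapp1993]; Greenberg–Vatsal (2000) §3 [GreenbergVatsal2000];
Pollack, Duke 118 (2003) Prop. 6.18 [Pollack2003].
-/

-- justification: the `Summit.BirchSwinnertonDyer.BirchSwinnertonDyer.…` path repeats a component (route-file convention)
set_option linter.dupNamespace false
set_option autoImplicit false

noncomputable section

open scoped MatrixGroups ComplexConjugate ModularForm NumberField Pointwise Classical
open CongruenceSubgroup Complex WeierstrassCurve IsDedekindDomain Polynomial Field Matrix Literature.NumberTheory.GaloisRepresentations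
open Literature.NumberTheory.EllipticCurves Literature.NumberTheory.EllipticCurves.ModularForms
open Literature.NumberTheory.EllipticCurves.Rank1Residual Rat.HeightOneSpectrum
open Summit.BirchSwinnertonDyer.BirchSwinnertonDyer.Theses.ResidualThetaTransportAtTwo

namespace Summit.BirchSwinnertonDyer.BirchSwinnertonDyer.Theorems.ThetaLayerLambdaCongruenceAtTwo

/-! ## §1 B4 (four cosets of `𝔪Λ`) from the cosocle count -/

/-- **B4 from multiplicity one in QUOTIENT form.** Let `𝔪` be a maximal ideal of `𝕋 = HeckeRing0 L 2` containing `2` with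
`|𝕋/𝔪| = 2` and `dim_{𝕋/𝔪} Λ/𝔪Λ = 2` (`Λ = periodHomologyHecke L`). Then `|Λ/𝔪Λ| = 4` and `Λ = periodHomology L` lies in the four
`𝔪Λ`-cosets of `0, v₁, v₂, v₁ + v₂` for some `v₁, v₂ ∈ Λ` — the statement consumed by the (K2) glue
`indexTwo_of_fourCosets_of_optimalQuotient`. No pairing is used. [cite: DarmonDiamondTaylor1995, §4.5 (pp. 133–134)] -/
theorem exists_fourCosets_periodHomology_of_cosocle {L : ℕ} [NeZero L] (𝔪 : Ideal (HeckeRing0 L 2)) [h𝔪 : 𝔪.IsMaximal]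
    (h2 : (2 : HeckeRing0 L 2) ∈ 𝔪) (hq : Nat.card (HeckeRing0 L 2 ⧸ 𝔪) = 2)
    (hcos : Module.finrank (HeckeRing0 L 2 ⧸ 𝔪)
      (periodHomologyHecke L ⧸ (𝔪 • ⊤ : Submodule (HeckeRing0 L 2) (periodHomologyHecke L))) = 2) :
    ∃ v₁ ∈ periodHomology L, ∃ v₂ ∈ periodHomology L, ∀ x ∈ periodHomology L,
      x ∈ 𝔪 • periodHomologyHecke L ∨ x - v₁ ∈ 𝔪 • periodHomologyHecke L ∨
      x - v₂ ∈ 𝔪 • periodHomologyHecke L ∨ x - (v₁ + v₂) ∈ 𝔪 • periodHomologyHecke L := by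
  classical
  letI : Field (HeckeRing0 L 2 ⧸ 𝔪) := Ideal.Quotient.field 𝔪
  haveI : Finite (HeckeRing0 L 2 ⧸ 𝔪) := Nat.finite_of_card_ne_zero (by rw [hq]; norm_num)
  haveI : Module.Finite (HeckeRing0 L 2 ⧸ 𝔪)
      (periodHomologyHecke L ⧸ (𝔪 • ⊤ : Submodule (HeckeRing0 L 2) (periodHomologyHecke L))) :=
    Module.finite_of_finrank_pos (by rw [hcos]; norm_num)
  have hcardP : Nat.card (periodHomologyHecke L ⧸ (𝔪 • ⊤ : Submodule (HeckeRing0 L 2) (periodHomologyHecke L))) ≤ 4 := by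
    rw [Module.natCard_eq_pow_finrank (K := HeckeRing0 L 2 ⧸ 𝔪)
      (V := periodHomologyHecke L ⧸ (𝔪 • ⊤ : Submodule (HeckeRing0 L 2) (periodHomologyHecke L))), hq, hcos]
    norm_num
  haveI hPfin : Finite (periodHomologyHecke L ⧸ (𝔪 • ⊤ : Submodule (HeckeRing0 L 2) (periodHomologyHecke L))) :=
    Module.finite_of_finite (HeckeRing0 L 2 ⧸ 𝔪)
  have h22 : ((2 : ℕ) : HeckeRing0 L 2) = 2 := Nat.cast_ofNat
  haveI : Finite ((periodHomologyHecke L) ⧸ (𝔪 • ⊤ : Submodule (HeckeRing0 L 2) (periodHomologyHecke L)).toAddSubgroup) := hPfin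
  obtain ⟨v₁, v₂, hv⟩ := exists_fourCosets_of_natCard_quotient_le_four
    (𝔪 • ⊤ : Submodule (HeckeRing0 L 2) (periodHomologyHecke L)).toAddSubgroup (fun x ↦ by
      rw [Submodule.mem_toAddSubgroup, ← Nat.cast_smul_eq_nsmul (HeckeRing0 L 2), h22]
      exact Submodule.smul_mem_smul h2 Submodule.mem_top) hcardP
  refine ⟨v₁, (mem_periodHomologyHecke L).mp v₁.2, v₂, (mem_periodHomologyHecke L).mp v₂.2, fun x hx ↦ ?_⟩
  have key := hv ⟨x, (mem_periodHomologyHecke L).mpr hx⟩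
  simp only [Submodule.mem_toAddSubgroup, mem_ideal_smul_top_iff] at key
  simpa using key

/-! ## §2 (K2) at the crux's own level from {MC} and the cosocle count at `𝔪₀` -/

/-- (SELF-DUALITY-FREE re-threading of `kTwo_of_dvd_noMC` (`…MazurTateCongruenceAtTwoRPlusLineOfManinConstant`): the two inputs
`hSD : heckeSelfDual_torsionBy_J0` and `hsub : dim_{𝕋/𝔪₀} J₀(L)[𝔪₀] = 2` are REPLACED by the single cosocle count
`hcos : dim_{𝕋/𝔪₀} Λ/𝔪₀Λ = 2`, B4 now coming from `exists_fourCosets_periodHomology_of_cosocle`; statement otherwise VERBATIM, proof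
copied with those two lines replaced.) **ITEM B5 and (K2) at the crux's own level.** `W/ℚ` globally minimal, good supersingular at `2`,
`Δ_W < 0`; newform `f` of level `N`; `S` a nonempty finite set of primes; a level `L` with `N·∏_{ℓ∈S} ℓ² ∣ L` and `primes(L) ⊆ S`;
`𝔪₀ = span{2, T_q − a_q(W) (q ∤ L), T_ℓ (ℓ ∣ L)}`. Inputs: `IsNewformOf.exists_maninConstant_ne_zero` and `hcos`. Conclusion (K2):
every additive `K ⊇ 2Λ, (T_q^∨ − a_q(W))Λ, U_ℓ^∨Λ,` cusp-negation differences has `x, y ∈ Λ ∖ K ⇒ x − y ∈ K`.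
[cite: DarmonDiamondTaylor1995, §4.5 Thm. 4.26 (shape)] [cite: Knapp1993, Thm. 11.74 (d)] -/
theorem kTwo_of_dvd_of_mcCosocle
    (hMC : IsNewformOf.exists_maninConstant_ne_zero)
    (W : WeierstrassCurve ℚ) [W.IsElliptic] [W.IsGloballyMinimal] (hss : GoodSS W 2) (hΔ : W.Δ < 0)
    {N : ℕ} [NeZero N] {f : CuspForm (Gamma0 N) 2} (hf : IsNewformOf W f)
    (S : Finset ℕ) (hS : ∀ ℓ ∈ S, ℓ.Prime) (_hSne : S.Nonempty)
    (L : ℕ) [NeZero L] (hNL : N * ∏ ℓ ∈ S, ℓ ^ 2 ∣ L) (hLS : ∀ p : ℕ, p.Prime → p ∣ L → p ∈ S)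
    (hcos : Module.finrank (HeckeRing0 L 2 ⧸ Ideal.span ({t : HeckeRing0 L 2 | t = 2 ∨ (∃ (q : ℕ) (hq : q.Prime), ¬ q ∣ L ∧
          t = HeckeRing0.T L 2 q hq - (W.LFunction q : HeckeRing0 L 2)) ∨ (∃ (q : ℕ) (hq : q.Prime), q ∣ L ∧
          t = HeckeRing0.T L 2 q hq)}))
      (periodHomologyHecke L ⧸ (Ideal.span ({t : HeckeRing0 L 2 | t = 2 ∨
          (∃ (q : ℕ) (hq : q.Prime), ¬ q ∣ L ∧ t = HeckeRing0.T L 2 q hq - (W.LFunction q : HeckeRing0 L 2)) ∨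
          (∃ (q : ℕ) (hq : q.Prime), q ∣ L ∧ t = HeckeRing0.T L 2 q hq)}) •
        (⊤ : Submodule (HeckeRing0 L 2) (periodHomologyHecke L)))) = 2)
    (K : AddSubgroup (Module.Dual ℂ (CuspForm (Gamma0 L) 2)))
    (h2K : ∀ x ∈ periodHomology L, (2 : ℂ) • x ∈ K)
    (hTK : ∀ (q : ℕ) (hq : q.Prime), ¬ q ∣ L → ∀ x ∈ periodHomology L,
      (haveI : NeZero q := ⟨hq.ne_zero⟩; heckeT (Gamma0 L) 2 q).dualMap x - (W.LFunction q : ℂ) • x ∈ K)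
    (hUK : ∀ (q : ℕ) (hq : q.Prime), q ∣ L → ∀ x ∈ periodHomology L,
      (haveI : NeZero q := ⟨hq.ne_zero⟩; heckeT (Gamma0 L) 2 q).dualMap x ∈ K)
    (hcK : ∀ γ : Gamma0 L, periodFunctional L ⟨iotaConj (γ : SL(2, ℤ)), iotaConj_coe_mem_gamma0 γ⟩ - periodFunctional L γ ∈ K)
    {x y : Module.Dual ℂ (CuspForm (Gamma0 L) 2)} (hx : x ∈ periodHomology L) (hy : y ∈ periodHomology L)
    (hxK : x ∉ K) (hyK : y ∉ K) : x - y ∈ K := by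
  classical
  set G : Set (HeckeRing0 L 2) := {t : HeckeRing0 L 2 | t = 2 ∨ (∃ (q : ℕ) (hq : q.Prime), ¬ q ∣ L ∧
      t = HeckeRing0.T L 2 q hq - (W.LFunction q : HeckeRing0 L 2)) ∨ (∃ (q : ℕ) (hq : q.Prime), q ∣ L ∧
      t = HeckeRing0.T L 2 q hq)} with hGdef
  -- the depleted form at level `L`
  have hint : ∀ n : ℕ, ∃ z : ℤ, cuspCoeff f n = z := fun n ↦ ⟨W.LFunction n, hf.2 n⟩
  have hTf : ∀ (p : ℕ) (hp : p.Prime), (haveI : NeZero p := ⟨hp.ne_zero⟩; heckeT (Gamma0 N) 2 p f) = cuspCoeff f p • f :=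
    fun p hp ↦ by haveI : NeZero p := ⟨hp.ne_zero⟩; exact hf.1.heckeT_eq_coeff_smul hp
  have hLS' : ∀ p : ℕ, p.Prime → p ∣ L → p ∣ N ∨ p ∈ S := fun p hp h ↦ Or.inr (hLS p hp h)
  obtain ⟨g, hg', hgi, hgr, hg1, hgT, hgU, hgall⟩ := exists_depleted_eigenform_of_dvd f hint hf.1.2.2 hTf S hS L hNL hLS'
  have hg : ∀ n : ℕ, cuspCoeff g n = if ∃ ℓ ∈ S, ℓ ∣ n then 0 else (W.LFunction n : ℂ) := fun n ↦ by rw [hg' n, hf.2 n]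
  -- primes of `L` are exactly `S`
  have hSL : ∀ ℓ ∈ S, ℓ ∣ L := fun ℓ hℓ ↦ (dvd_level_of_mem (M := N) (S := S) rfl hℓ).trans hNL
  have hLiff : ∀ q : ℕ, q.Prime → (q ∣ L ↔ q ∈ S) := fun q hq ↦ ⟨hLS q hq, hSL q⟩
  -- the optimal quotient and `W ~ A`
  obtain ⟨A, hAell, hAmin, LA, c, hLA, hc, hlat, hiso⟩ :=
    MazurTateCongruenceAtTwoR.DepletedLattice.exists_depletedLatticeCurve_isIsogenous hMC W hf S hS L hNL g hg'
  obtain ⟨ψ, hcyc⟩ := hiso.exists_isCyclic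
  -- the eigen-ideal acts on `g` by even integers and contains `2`
  have h2 : (2 : HeckeRing0 L 2) ∈ Ideal.span G := Ideal.subset_span (Or.inl rfl)
  have hb : ∀ (q : ℕ) (hq : q.Prime), (haveI : NeZero q := ⟨hq.ne_zero⟩; heckeT (Gamma0 L) 2 q g) =
      (((if q ∈ S then 0 else W.LFunction q : ℤ)) : ℂ) • g := fun q hq ↦ by
    rw [hgall q hq, hg q]
    by_cases hqS : q ∈ S
    · rw [if_pos ⟨q, hqS, dvd_rfl⟩, if_pos hqS, Int.cast_zero]
    · rw [if_neg, if_neg hqS]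
      rintro ⟨ℓ, hℓ, hd⟩
      exact hqS (((Nat.prime_dvd_prime_iff_eq (hS ℓ hℓ) hq).mp hd) ▸ hℓ)
  have h𝔪 : ∀ t ∈ Ideal.span G, ∃ e : ℤ, HeckeRing0.toEnd L 2 t g = ((2 * e : ℤ) : ℂ) • g := by
    refine ideal_span_acts_even g (fun q ↦ if q ∈ S then 0 else W.LFunction q) hb G fun t ht ↦ ?_
    rcases ht with rfl | ⟨q, hq, hqL, rfl⟩ | ⟨q, hq, hqL, rfl⟩
    · exact Or.inl rfl
    · refine Or.inr ⟨q, hq, ?_⟩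
      rw [if_neg (fun h ↦ hqL ((hLiff q hq).mpr h))]
    · refine Or.inr ⟨q, hq, ?_⟩
      rw [if_pos ((hLiff q hq).mp hqL), Int.cast_zero, sub_zero]
  -- B5 at level `L`: a witness outside `𝔪₀Λ`, hence `𝔪₀ ≠ ⊤`, `|𝕋/𝔪₀| = 2`, maximal
  obtain ⟨γ₀, hγ₀⟩ := exists_periodFunctional_iotaConj_add_notMem_of_optimalQuotient W hss hΔ g hgr A hLA hc hlat ψ hcyc
    (Ideal.span G) h𝔪
  have hne : Ideal.span G ≠ ⊤ := by
    intro htop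
    apply hγ₀
    rw [htop, Submodule.top_smul]
    exact (mem_periodHomologyHecke L).mpr
      (add_mem (periodFunctional_mem_periodHomology L _) (periodFunctional_mem_periodHomology L γ₀))
  have hq := natCard_quotient_eq_two_of_ne_top (Ideal.span G) h2 (eigenIdeal_T_sub_int_mem W) hne
  haveI : (Ideal.span G).IsMaximal := isMaximal_of_natCard_quotient_eq_two _ hq
  -- B4 quotient form from the cosocle count (§1), then the (K2) glue
  obtain ⟨v₁, -, v₂, hv₂, hcov⟩ := exists_fourCosets_periodHomology_of_cosocle _ h2 hq hcos
  have hK𝔪 : ∀ z ∈ Ideal.span G • periodHomologyHecke L, z ∈ K := by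
    refine mem_of_mem_ideal_span_smul G K fun s hs z hz ↦ ?_
    rcases hs with rfl | ⟨q, hq', hqL, rfl⟩ | ⟨q, hq', hqL, rfl⟩
    · have : (2 : HeckeRing0 L 2) • z = (2 : ℂ) • z := by
        rw [show (2 : HeckeRing0 L 2) = ((2 : ℤ) : HeckeRing0 L 2) by norm_num, heckeRing0_intCast_smul, Int.cast_ofNat]
      rw [this]
      exact h2K z hz
    · rw [sub_smul, heckeRing0_T_smul, heckeRing0_intCast_smul]
      exact hTK q hq' hqL z hz
    · rw [heckeRing0_T_smul]
      exact hUK q hq' hqL z hz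
  exact indexTwo_of_fourCosets_of_optimalQuotient W hss hΔ g hgr A hLA hc hlat ψ hcyc (Ideal.span G) h2 h𝔪 K hK𝔪 hcK hv₂
    hcov hx hy hxK hyK

/-! ## §3 The Galois-side hypotheses of Buzzard's Prop. 2.4 at the mod-`2` eigen-ideal of a good-supersingular-at-`2` curve -/

/-- **Buzzard's hypotheses, discharged once for every conclusion.** `W/ℚ` globally minimal with `GoodSS W 2`; `L` a level; every prime
`p ∤ 2L` good for `W`; `𝔪` an ideal of `𝕋 = HeckeRing0 L 2` with `|𝕋/𝔪| = 2` and `T_q - a_q(W) ∈ 𝔪` for all primes `q ∤ L`. Then the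
hypothesis list of `buzzard2000_multiplicityOne_gamma0` AS TYPED holds with `k = 𝔽̄₂` (discrete), `ι : 𝕋/𝔪 ≅ 𝔽₂ → k`, `ρ = ρ̄_{W,2} ⊗ k`:
(U) unramified with `charpoly ρ(Frob_p) = X² - ι(T_p) X + p` at `p ∤ 2L` (Eichler–Shimura / Hasse–Weil for `W` at good `p`);
(I) irreducible over `k` — `ρ̄_{W,2}` is ONTO `GL₂(𝔽₂)` (Dokchitser–Dokchitser (1): no rational `2`-torsion, `Δ ∉ ℚ²`), so its image
contains both transvections; (S) non-scalar on every `D_𝔓`, `𝔓 ∣ 2` — some `σ ∈ D_𝔓` has `ρ̄(σ) ≠ 1` (the `2`-division field is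
ramified at `2`), and over `𝔽₂` the only scalar in `GL₂` is `1`. Hence ANY statement `P` that follows from these hypotheses (the
conclusion of a fact of Buzzard's printed shape, on whatever carrier it is read) holds. (= `finrank_torsionBySet_eq_two_of_buzzard`,
`…MazurTateCongruenceAtTwoRPlusLineThreeFacts`, with the conclusion abstracted to `P`; proof copied.)
[cite: Buzzard2000LevelLoweringModTwo, Prop. 2.4 and Def. 2.1–2.2 (p. 100–101)] [cite: DokchitserDokchitserMathZ2012, Theorem (1)] -/
theorem of_buzzardHypotheses
    (W : WeierstrassCurve ℚ) [W.IsElliptic] [W.IsGloballyMinimal] (hss : GoodSS W 2)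
    (L : ℕ) [NeZero L]
    (hgood : ∀ v : HeightOneSpectrum (𝓞 ℚ), ¬ ((primesEquiv v : ℕ) ∣ 2 * L) → W.HasGoodReductionAt v)
    (𝔪 : Ideal (HeckeRing0 L 2)) (hq : Nat.card (HeckeRing0 L 2 ⧸ 𝔪) = 2)
    (hT : ∀ (q : ℕ) (hq : q.Prime), ¬ q ∣ L → HeckeRing0.T L 2 q hq - (W.LFunction q : HeckeRing0 L 2) ∈ 𝔪)
    {P : Prop}
    (hFact : ∀ (k : Type) [Field k] [IsAlgClosed k] [TopologicalSpace k] [DiscreteTopology k]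
      (ι : HeckeRing0 L 2 ⧸ 𝔪 →+* k) (ρ : ModPGaloisRep ℚ k 2),
      (∀ v : HeightOneSpectrum (𝓞 ℚ), ¬ ((primesEquiv v : Nat.Primes) : ℕ) ∣ 2 * L →
        ρ.IsUnramifiedAt v ∧
          ρ.HasFrobCharpolyAt v
            (X ^ 2
              - C (ι (Ideal.Quotient.mk 𝔪 (HeckeRing0.T L 2
                  ((primesEquiv v : Nat.Primes) : ℕ) (primesEquiv v : Nat.Primes).2))) * X
              + C (((primesEquiv v : Nat.Primes) : ℕ) : k))) →
      FramedRep.IsIrreducible ρ →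
      (∀ v : HeightOneSpectrum (𝓞 ℚ), ((primesEquiv v : Nat.Primes) : ℕ) = 2 →
        ∀ 𝔓 ∈ v.primesAbove, ∃ σ ∈ 𝔓.decompositionSubgroup (Field.absoluteGaloisGroup ℚ),
          ∀ c : k, ((ρ σ : GL (Fin 2) k) : Matrix (Fin 2) (Fin 2) k) ≠ Matrix.scalar (Fin 2) c) → P) :
    P := by
  classical
  -- the coefficient field `k = 𝔽̄₂` (discrete) and `ι : 𝕋/𝔪 ≅ 𝔽₂ → k`
  let k : Type := AlgebraicClosure (ZMod 2)
  letI : TopologicalSpace k := ⊥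
  haveI : DiscreteTopology k := ⟨rfl⟩
  haveI : Finite (HeckeRing0 L 2 ⧸ 𝔪) := Nat.finite_of_card_ne_zero (by rw [hq]; norm_num)
  letI : Fintype (HeckeRing0 L 2 ⧸ 𝔪) := Fintype.ofFinite _
  have hF : Fintype.card (HeckeRing0 L 2 ⧸ 𝔪) = 2 := by rw [Fintype.card_eq_nat_card, hq]
  let e : ZMod 2 ≃+* HeckeRing0 L 2 ⧸ 𝔪 := ZMod.ringEquivOfPrime _ Nat.prime_two hF
  let f : ZMod 2 →+* k := algebraMap (ZMod 2) k
  let ι : HeckeRing0 L 2 ⧸ 𝔪 →+* k := f.comp e.symm.toRingHom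
  have hι : ∀ a : ℤ, ι (Ideal.Quotient.mk 𝔪 (a : HeckeRing0 L 2)) = (a : k) := fun a ↦ by
    simp only [map_intCast]
  -- the mod-`2` representation of `W` and its base change to `k`
  obtain ⟨ρ₀, hρ₀⟩ := W.exists_isTorsionGaloisRep 2
  let ρ : ModPGaloisRep ℚ k 2 := FramedRep.baseChange f continuous_of_discreteTopology ρ₀
  have hρapp : ∀ σ, ((ρ σ : GL (Fin 2) k) : Matrix (Fin 2) (Fin 2) k) =
      ((ρ₀ σ : GL (Fin 2) (ZMod 2)) : Matrix (Fin 2) (Fin 2) (ZMod 2)).map f := fun σ ↦ rfl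
  refine hFact k ι ρ ?_ ?_ ?_
  · -- (U) unramified with the Eichler–Shimura characteristic polynomial at `p ∤ 2L`
    intro v hv
    have hp2 : ¬ ((primesEquiv v : Nat.Primes) : ℕ) ∣ 2 := fun h ↦ hv (h.mul_right L)
    have hpL : ¬ ((primesEquiv v : Nat.Primes) : ℕ) ∣ L := fun h ↦ hv (Dvd.dvd.mul_left h 2)
    have hgoodv : W.HasGoodReductionAt v := hgood v hv
    have h2v : ((2 : ℕ) : 𝓞 ℚ) ∉ v.asIdeal := fun h ↦ hp2 ((natCast_mem_asIdeal_iff_primesEquiv_dvd v 2).mp h)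
    refine ⟨?_, ?_⟩
    · intro 𝔓 h𝔓 σ hσ
      have h1 : ρ₀ σ = 1 := hρ₀.isUnramifiedAt_of_hasGoodReductionAt hgoodv h2v 𝔓 h𝔓 σ hσ
      change Matrix.GeneralLinearGroup.map f (ρ₀ σ) = 1
      rw [h1, map_one]
    · intro 𝔓 h𝔓 σ hσ
      have hc := hρ₀.charpoly_eq_of_isArithFrobAt (W.trace_galoisRepTate_frobenius_of_hasGoodReductionAt_holds 2)
        (W.det_galoisRepTate_frobenius_of_hasGoodReductionAt_holds 2) h2v hgoodv h𝔓 hσ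
      have hTp : ι (Ideal.Quotient.mk 𝔪 (HeckeRing0.T L 2 ((primesEquiv v : Nat.Primes) : ℕ) (primesEquiv v).2)) =
          ((W.frobeniusTraceAt v : ℤ) : k) := by
        have hmk : Ideal.Quotient.mk 𝔪 (HeckeRing0.T L 2 ((primesEquiv v : Nat.Primes) : ℕ) (primesEquiv v).2) =
            Ideal.Quotient.mk 𝔪 ((W.LFunction (primesEquiv v : ℕ) : ℤ) : HeckeRing0 L 2) := by
          rw [Ideal.Quotient.mk_eq_mk_iff_sub_mem]
          exact hT _ (primesEquiv v).2 hpL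
        rw [hmk, hι, W.lFunction_primesEquiv_eq_frobeniusTraceAt hgoodv]
      change (((ρ σ : GL (Fin 2) k) : Matrix (Fin 2) (Fin 2) k)).charpoly = _
      rw [hρapp, Matrix.charpoly_map, hc, hTp, natCard_residueField_adicCompletionIntegers v]
      simp only [Polynomial.map_add, Polynomial.map_sub, Polynomial.map_mul, Polynomial.map_pow, Polynomial.map_X,
        Polynomial.map_C]
      rw [map_intCast f, map_natCast f]
  · -- (I) irreducible over `k`: the image contains both transvections (§1: `ρ̄_{W,2}` is onto `GL₂(𝔽₂)`)
    obtain ⟨T₁, hT₁⟩ := exists_GL_coe_eq_upperTransvection (ZMod 2)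
    obtain ⟨T₂, hT₂⟩ := exists_GL_coe_eq_lowerTransvection (ZMod 2)
    obtain ⟨σ₁, h₁⟩ := exists_apply_eq_of_goodSS_two W hss hρ₀ T₁
    obtain ⟨σ₂, h₂⟩ := exists_apply_eq_of_goodSS_two W hss hρ₀ T₂
    have e₁ : ((ρ σ₁ : GL (Fin 2) k) : Matrix (Fin 2) (Fin 2) k) = !![(1 : k), 1; 0, 1] := by
      rw [hρapp, h₁, hT₁, map_upperTransvection]
    have e₂ : ((ρ σ₂ : GL (Fin 2) k) : Matrix (Fin 2) (Fin 2) k) = !![(1 : k), 0; 1, 1] := by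
      rw [hρapp, h₂, hT₂, map_lowerTransvection]
    refine isIrreducible_of_not_hasCommonEigenvector ρ.toMonoidHom ?_
    rintro ⟨w, hw0, hw⟩
    obtain ⟨a, ha⟩ := hw σ₁
    obtain ⟨b, hb⟩ := hw σ₂
    change ((ρ σ₁ : GL (Fin 2) k) : Matrix (Fin 2) (Fin 2) k) *ᵥ w = a • w at ha
    change ((ρ σ₂ : GL (Fin 2) k) : Matrix (Fin 2) (Fin 2) k) *ᵥ w = b • w at hb
    rw [e₁] at ha
    rw [e₂] at hb
    exact hw0 (eq_zero_of_transvections_mulVec_eq_smul ha hb)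
  · -- (S) non-scalar on the decomposition groups at `2` (§2: some `σ ∈ D_𝔓` has `ρ̄(σ) ≠ 1`; over `𝔽₂` the only scalar unit is `1`)
    intro v hv 𝔓 h𝔓
    obtain ⟨σ, hσ, hne⟩ := exists_mem_decompositionSubgroup_apply_ne_one_of_goodSS_two W hss hρ₀ hv h𝔓
    refine ⟨σ, hσ, fun c hc ↦ hne ?_⟩
    have hf : Function.Injective f := (algebraMap (ZMod 2) k).injective
    rw [hρapp] at hc
    have hent : ∀ i j, f (((ρ₀ σ : GL (Fin 2) (ZMod 2)) : Matrix (Fin 2) (Fin 2) (ZMod 2)) i j) =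
        Matrix.scalar (Fin 2) c i j := fun i j ↦ by
      rw [← hc]; rfl
    have h01 : ((ρ₀ σ : GL (Fin 2) (ZMod 2)) : Matrix (Fin 2) (Fin 2) (ZMod 2)) 0 1 = 0 :=
      hf (by rw [hent, map_zero]; simp)
    have h10 : ((ρ₀ σ : GL (Fin 2) (ZMod 2)) : Matrix (Fin 2) (Fin 2) (ZMod 2)) 1 0 = 0 :=
      hf (by rw [hent, map_zero]; simp)
    have hdet : IsUnit (((ρ₀ σ : GL (Fin 2) (ZMod 2)) : Matrix (Fin 2) (Fin 2) (ZMod 2)) 0 0 *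
        ((ρ₀ σ : GL (Fin 2) (ZMod 2)) : Matrix (Fin 2) (Fin 2) (ZMod 2)) 1 1) := by
      have h := (Matrix.isUnit_iff_isUnit_det _).mp (ρ₀ σ).isUnit
      rwa [Matrix.det_fin_two, h01, zero_mul, sub_zero] at h
    have hcases : ∀ x : ZMod 2, x ≠ 0 → x = 1 := by decide
    have h00 := hcases _ (IsUnit.mul_iff.mp hdet).1.ne_zero
    have h11 := hcases _ (IsUnit.mul_iff.mp hdet).2.ne_zero
    refine Matrix.GeneralLinearGroup.ext fun i j ↦ ?_
    rw [Units.val_one]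
    fin_cases i <;> fin_cases j
    · simpa using h00
    · simpa using h01
    · simpa using h10
    · simpa using h11

end Summit.BirchSwinnertonDyer.BirchSwinnertonDyer.Theorems.ThetaLayerLambdaCongruenceAtTwo

end
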